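import Literature.Computability.Cryptography.CsidhActionEndRingProofs
import Literature.Computability.Cryptography.CsidhActionCompProofs
import HarnessLib

/-!
# The CSIDH class-group action is free (clause (3), uniqueness half)

Sibling *proofs* file (theorems only, D-0014/D-0026) of
`Literature.Computability.Cryptography.CsidhAction`, proving the **freeness** part of clause (3)
of the named fact `csidh_classGroupAction` (Castryck–Lange–Martindale–Panny–Renes, *CSIDH*,
ASIACRYPT 2018, §3 Thm. 7 (Waterhouse): "`cl(𝒪)` acts freely … on `Ell_p(𝒪, π)`"): for
`p ≡ 3 (mod 8)`, `p ≥ 5`, labels `f, g` and a valid `A`, `act p f A = act p g A → f = g`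
(`eq_of_act_eq_act`). By `eq_of_act_eq_act_of_free` (the group-action algebra of clause (2)) it
suffices to show point-wise freeness `act p k A = A → k = (1, 0, p)` (`eq_principalForm_of_act_eq`).

Proof of point-wise freeness. An `𝔽_p`-isogeny `E_A → E_{act k A} = E_A` with kernel `E_A[𝔞_k]`
is an `𝔽_p`-endomorphism, hence `z = m + nπ ∈ ℤ[π] = End_p(E_A)` (`exists_int_int_apply_eq`).
Its kernel `E_A[𝔞_k] = {T : aT = O, πT = b'T}` (`k = (a, 2b', c)`) has at most `a` points — an
eigenspace of `π` in `E[N]` has order `≤ N`, because `π` is not a scalar on any `E[ℓ]`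
(`false_of_frob_eq_smul_on_torsion`) and a finite abelian group killed by `N` all of whose
`ℓ`-socles have order `≤ ℓ` has order `≤ N` — and `a < p` for a reduced form of discriminant
`-4p`. But for `m, n ≠ 0` the kernel of `m + nπ` has at least `p` points (reduce to `gcd(m, n) = 1`,
`p ∤ m`; with `N = m² + n²p`, `z` maps `E[N] ≅ (ℤ/N)²`-many points into the eigenspace
`ker z̄ ∩ E[N]`, of order `≤ N`). Hence `z = m` or `z = nπ`, `E_A[𝔞_k] = E_A[m₀]`, and since
`E_A[m₀] ⊆ ker(π - b')` the integer `m₀` is `± p^j`, i.e. `E_A[𝔞_k] = O`. Finally `a = 1`: for a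
prime `ℓ ∣ a`, `(π - b')(π + b') = -(ac) = 0` on `E[ℓ]` and `π ≠ -b'` on `E[ℓ]` give a non-zero
point of `E[ℓ] ∩ ker(π - b') ⊆ E_A[𝔞_k]`. A reduced form `(1, b, c)` of discriminant `-4p` is
`(1, 0, p)`.

## References

* [CastryckEtAl2018] W. Castryck, T. Lange, C. Martindale, L. Panny, J. Renes, *CSIDH*,
  ASIACRYPT 2018, §3 Thm. 7, §4.
* [Waterhouse1969] W. C. Waterhouse, *Abelian varieties over finite fields*, Ann. Sci. ÉNS (4) 2
  (1969), Thm. 4.5.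

## Design

`noncomputable section`, `open scoped Classical`; theorems only, no definitions, no new named
facts.
-/

noncomputable section

open scoped Classical

namespace Literature.Computability.Cryptography.Csidh

open Literature.NumberTheory.QuadraticFields.Quadratic
open Literature.NumberTheory.QuadraticFields.Quadratic.BinQF
open WeierstrassCurve

universe u

variable {p : ℕ} [Fact p.Prime]

/-! ### A socle bound for finite abelian groups -/

omit [Fact p.Prime] in
/-- **Socle bound.** A finite abelian group `G` killed by `N ≥ 1`, all of whose `ℓ`-torsion
subgroups (`ℓ ∣ N` prime) have at most `ℓ` elements, has at most `N` elements: `#G = #G[ℓ] · #ℓG`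
and `ℓG` is killed by `N/ℓ`. [folklore] -/
theorem natCard_le_of_card_torsion_le :
    ∀ (N : ℕ) {G : Type u} [AddCommGroup G] [Finite G], 0 < N →
      (∀ x : G, (N : ℤ) • x = 0) →
      (∀ ℓ : ℕ, ℓ.Prime → ℓ ∣ N → Nat.card {x : G // (ℓ : ℤ) • x = 0} ≤ ℓ) →
      Nat.card G ≤ N := by
  intro N
  induction N using Nat.strong_induction_on with
  | _ N ih =>
    intro G _ _ hN hG hℓ
    by_cases h1 : N = 1
    · subst h1
      have : Subsingleton G := ⟨fun x y ↦ by
        have hx := hG x; have hy := hG y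
        rw [Nat.cast_one, one_smul] at hx hy
        rw [hx, hy]⟩
      exact (Nat.card_eq_one_iff_unique.2 ⟨this, ⟨0⟩⟩).le
    · -- `ℓ = minFac N`, `N = ℓ N'`
      set ℓ := N.minFac with hℓdef
      have hℓp : ℓ.Prime := Nat.minFac_prime h1
      obtain ⟨N', hN'⟩ : ℓ ∣ N := Nat.minFac_dvd N
      have hN'pos : 0 < N' := Nat.pos_of_ne_zero fun h ↦ by rw [h, mul_zero] at hN'; omega
      have hN'lt : N' < N := by
        rw [hN']
        exact lt_mul_left hN'pos hℓp.one_lt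
      -- `f = [ℓ]`, `#G = #ker f · #range f`
      set f : G →+ G := zsmulAddGroupHom (ℓ : ℤ) with hf
      have hcard : Nat.card G = Nat.card f.range * Nat.card f.ker := by
        rw [AddSubgroup.card_eq_card_quotient_mul_card_addSubgroup f.ker,
          Nat.card_congr (QuotientAddGroup.quotientKerEquivRange f).toEquiv]
      -- `#ker f ≤ ℓ`
      have hker : Nat.card f.ker ≤ ℓ := by
        refine le_trans (le_of_eq (Nat.card_congr (Equiv.subtypeEquivRight fun x ↦ ?_)))
          (hℓ ℓ hℓp ⟨N', hN'⟩)
        rw [AddMonoidHom.mem_ker, hf, zsmulAddGroupHom_apply]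
      -- `#range f ≤ N'` by induction
      have hrange : Nat.card f.range ≤ N' := by
        refine ih N' hN'lt hN'pos (fun y ↦ ?_) fun q hq hqN' ↦ ?_
        · obtain ⟨x, hx⟩ := y.2
          apply Subtype.ext
          show (N' : ℤ) • (y : G) = 0
          rw [← hx, hf, zsmulAddGroupHom_apply, smul_smul, ← hG x, hN', Nat.cast_mul, mul_comm]
        · refine le_trans (Nat.card_le_card_of_injective
            (fun y : {y : f.range // (q : ℤ) • y = 0} ↦
              (⟨(y.1 : G), by
                have := y.2
                rw [Subtype.ext_iff] at this
                exact this⟩ : {x : G // (q : ℤ) • x = 0}))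
            fun y₁ y₂ h ↦ ?_) (hℓ q hq (hqN'.trans ⟨ℓ, by rw [hN', mul_comm]⟩))
          simp only [Subtype.mk.injEq] at h
          exact Subtype.ext (Subtype.ext h)
      rw [hcard, hN', mul_comm ℓ N']
      exact Nat.mul_le_mul hrange hker

/-! ### Torsion and eigenspaces of `π` on a valid `E_A` -/

/-- **`E_A[p] = O`** (`π² = -p` and `π` is a bijection). [cite: CastryckEtAl2018, §4] -/
theorem eq_zero_of_p_zsmul (hp8 : p % 8 = 3) {A : ZMod p} (hA : IsCoeff p A)
    {T : (curve p A).geomPoints} (h : (p : ℤ) • T = 0) : T = 0 := by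
  have h2 := frob_smul_frob_smul hp8 hA T
  rw [h, neg_zero, smul_eq_zero_iff_eq, smul_eq_zero_iff_eq] at h2
  exact h2

/-- `E_A[p^j] = O`. [folklore] -/
theorem eq_zero_of_p_pow_zsmul (hp8 : p % 8 = 3) {A : ZMod p} (hA : IsCoeff p A) (j : ℕ)
    {T : (curve p A).geomPoints} (h : ((p : ℤ) ^ j) • T = 0) : T = 0 := by
  induction j generalizing T with
  | zero => rwa [pow_zero, one_smul] at h
  | succ j ih =>
    rw [pow_succ, mul_smul] at h
    exact eq_zero_of_p_zsmul hp8 hA (ih h)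

/-- `#E_A[ℓ] = ℓ²` for a prime `ℓ ≠ p`. [cite: SilvermanAEC2009, Cor. III.6.4(b)] -/
theorem natCard_geomTorsion_prime (hp8 : p % 8 = 3) {A : ZMod p} (hA : IsCoeff p A)
    {N : ℕ} (hN : ¬ p ∣ N) : Nat.card (geomTorsion (curve p A) N) = N ^ 2 := by
  haveI := isElliptic_of_isCoeff hp8 hA
  haveI : NeZero p := ⟨(Fact.out : p.Prime).ne_zero⟩
  have hNK : (N : AlgebraicClosure (ZMod p)) ≠ 0 := by
    intro h0
    apply hN
    rw [← map_natCast (algebraMap (ZMod p) (AlgebraicClosure (ZMod p))), map_eq_zero] at h0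
    exact (ZMod.natCast_eq_zero_iff N p).1 h0
  exact card_torsionBy_eq_sq (E := (curve p A).baseChange (AlgebraicClosure (ZMod p))) hNK

/-- `E_A[N] ∩ ker(π - c)` inside `E_A[N]`, for `ℓ ∣ N` prime, has `ℓ`-socle of order `≤ ℓ`:
otherwise it would contain all of `E_A[ℓ]` and `π = c` on `E_A[ℓ]`. [folklore] -/
theorem natCard_torsion_eigen_prime_le (hp8 : p % 8 = 3) {A : ZMod p} (hA : IsCoeff p A)
    {ℓ : ℕ} (hℓ : ℓ.Prime) (c : ℤ) :
    Nat.card {T : (curve p A).geomPoints // (ℓ : ℤ) • T = 0 ∧ frob p • T = c • T} ≤ ℓ := by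
  haveI := isElliptic_of_isCoeff hp8 hA
  by_cases hℓp : ℓ = p
  · -- `E[p] = 0`
    subst ℓ
    have : Subsingleton {T : (curve p A).geomPoints // (p : ℤ) • T = 0 ∧ frob p • T = c • T} :=
      ⟨fun x y ↦ Subtype.ext (by rw [eq_zero_of_p_zsmul hp8 hA x.2.1, eq_zero_of_p_zsmul hp8 hA y.2.1])⟩
    exact (Nat.card_eq_one_iff_unique.2 ⟨this, ⟨⟨0, by simp⟩⟩⟩).le.trans hℓ.one_lt.le
  · set H : AddSubgroup (curve p A).geomPoints :=
      geomTorsion (curve p A) ℓ ⊓ frobEigen (curve p A) c with hH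
    have hHle : H ≤ geomTorsion (curve p A) ℓ := inf_le_left
    have hcardE : Nat.card (geomTorsion (curve p A) ℓ) = ℓ ^ 2 :=
      natCard_geomTorsion_prime hp8 hA (N := ℓ) fun h ↦
        hℓp ((Nat.prime_dvd_prime_iff_eq Fact.out hℓ).1 h).symm
    haveI : Finite (geomTorsion (curve p A) ℓ) := Nat.finite_of_card_ne_zero (by
      rw [hcardE]; exact pow_ne_zero _ hℓ.ne_zero)
    have hcardH : Nat.card H = Nat.card {T : (curve p A).geomPoints //
        (ℓ : ℤ) • T = 0 ∧ frob p • T = c • T} :=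
      Nat.card_congr (Equiv.subtypeEquivRight fun T ↦ by
        rw [hH, AddSubgroup.mem_inf, mem_frobEigen_iff]
        exact and_congr (Submodule.mem_torsionBy_iff _ _) Iff.rfl)
    rw [← hcardH]
    have hdvd : Nat.card H ∣ ℓ ^ 2 := hcardE ▸ AddSubgroup.card_dvd_of_le hHle
    obtain ⟨i, hi, hci⟩ := (Nat.dvd_prime_pow hℓ).1 hdvd
    interval_cases i
    · rw [hci, pow_zero]; exact hℓ.one_lt.le
    · rw [hci, pow_one]
    · -- `H = E[ℓ]`: `π = c` on `E[ℓ]`, impossible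
      exfalso
      have hHeq : H = geomTorsion (curve p A) ℓ :=
        AddSubgroup.eq_of_le_of_card_ge hHle (by rw [hcardE, hci])
      refine false_of_frob_eq_smul_on_torsion hp8 hA hℓ hℓp c fun T hT ↦ ?_
      have hmem : T ∈ H := by rw [hHeq]; exact (Submodule.mem_torsionBy_iff _ _).2 hT
      rw [hH, AddSubgroup.mem_inf, mem_frobEigen_iff] at hmem
      exact hmem.2

/-- `E_A[N] ∩ ker(π - c)` is finite for `N ≠ 0`. [folklore] -/
theorem finite_torsion_eigen (hp8 : p % 8 = 3) {A : ZMod p} (hA : IsCoeff p A)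
    {N : ℕ} (hN : N ≠ 0) (c : ℤ) :
    Finite {T : (curve p A).geomPoints // (N : ℤ) • T = 0 ∧ frob p • T = c • T} := by
  haveI := isElliptic_of_isCoeff hp8 hA
  haveI : Finite (geomTorsion (curve p A) N) :=
    finite_torsionPoints_holds (curve p A) (AlgebraicClosure (ZMod p)) (by exact_mod_cast hN)
  exact Finite.of_injective (fun T : {T : (curve p A).geomPoints //
      (N : ℤ) • T = 0 ∧ frob p • T = c • T} ↦
      (⟨T.1, (Submodule.mem_torsionBy_iff _ _).2 T.2.1⟩ : geomTorsion (curve p A) N))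
    fun a b h ↦ Subtype.ext (by simpa using congrArg Subtype.val h)

/-- **Eigenspace bound**: `#(E_A[N] ∩ ker(π - c)) ≤ N` for `N ≥ 1` and any integer `c`.
[folklore] -/
theorem natCard_torsion_eigen_le (hp8 : p % 8 = 3) {A : ZMod p} (hA : IsCoeff p A)
    {N : ℕ} (hN : 0 < N) (c : ℤ) :
    Nat.card {T : (curve p A).geomPoints // (N : ℤ) • T = 0 ∧ frob p • T = c • T} ≤ N := by
  haveI := isElliptic_of_isCoeff hp8 hA
  set H : AddSubgroup (curve p A).geomPoints :=
    geomTorsion (curve p A) N ⊓ frobEigen (curve p A) c with hH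
  haveI := finite_torsion_eigen hp8 hA hN.ne' c
  have hcardH : Nat.card H = Nat.card {T : (curve p A).geomPoints //
      (N : ℤ) • T = 0 ∧ frob p • T = c • T} :=
    Nat.card_congr (Equiv.subtypeEquivRight fun T ↦ by
      rw [hH, AddSubgroup.mem_inf, mem_frobEigen_iff]
      exact and_congr (Submodule.mem_torsionBy_iff _ _) Iff.rfl)
  haveI : Nonempty {T : (curve p A).geomPoints // (N : ℤ) • T = 0 ∧ frob p • T = c • T} :=
    ⟨⟨0, by simp⟩⟩
  haveI : Finite H := Nat.finite_of_card_ne_zero (by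
    rw [hcardH]
    exact (Nat.card_pos (α := {T : (curve p A).geomPoints //
      (N : ℤ) • T = 0 ∧ frob p • T = c • T})).ne')
  rw [← hcardH]
  refine natCard_le_of_card_torsion_le N hN (fun x ↦ Subtype.ext ?_) fun ℓ hℓ _ ↦ ?_
  · have hx : (x : (curve p A).geomPoints) ∈ geomTorsion (curve p A) N :=
      (AddSubgroup.mem_inf.1 x.2).1
    exact_mod_cast (Submodule.mem_torsionBy_iff _ _).1 hx
  · haveI := finite_torsion_eigen hp8 hA hℓ.ne_zero c
    refine le_trans (Nat.card_le_card_of_injective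
      (fun y : {y : H // (ℓ : ℤ) • y = 0} ↦
        (⟨(y.1 : (curve p A).geomPoints), ⟨by exact_mod_cast y.2,
          (AddSubgroup.mem_inf.1 y.1.2).2⟩⟩ :
          {T : (curve p A).geomPoints // (ℓ : ℤ) • T = 0 ∧ frob p • T = c • T}))
      fun y₁ y₂ h ↦ ?_) (natCard_torsion_eigen_prime_le hp8 hA hℓ c)
    simp only [Subtype.mk.injEq] at h
    exact Subtype.ext (Subtype.ext h)

/-! ### Kernels of `m + nπ` -/

/-- `z̄ z = N(z)`: if `mT + nπT = O` then `(m² + n²p) T = O`. [folklore] -/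
theorem norm_zsmul_eq_zero_of_zact_eq_zero (hp8 : p % 8 = 3) {A : ZMod p} (hA : IsCoeff p A)
    {m n : ℤ} {T : (curve p A).geomPoints} (h : m • T + n • (frob p • T) = 0) :
    (m * m + n * n * p) • T = 0 := by
  have h2 : m • (m • T + n • (frob p • T)) - n • (frob p • (m • T + n • (frob p • T))) = 0 := by
    rw [h]; simp
  simp only [smul_add, frob_smul_zsmul, frob_smul_frob_smul hp8 hA] at h2
  generalize frob p • T = X at h2
  linear_combination (norm := module) h2

/-- `ker(m + nπ) ⊆ E_A[m² + n²p]`. [folklore] -/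
theorem ker_zact_le_geomTorsion (hp8 : p % 8 = 3) {A : ZMod p} (hA : IsCoeff p A) (m n : ℤ) :
    (zact p A ⟨m, n⟩).ker ≤ geomTorsion (curve p A) (m * m + n * n * p) := fun T hT ↦ by
  rw [AddMonoidHom.mem_ker, zact_apply] at hT
  exact (Submodule.mem_torsionBy_iff _ _).2 (norm_zsmul_eq_zero_of_zact_eq_zero hp8 hA hT)

/-- `ker(m + nπ)` is finite for `(m, n) ≠ (0, 0)`. [folklore] -/
theorem finite_ker_zact (hp8 : p % 8 = 3) {A : ZMod p} (hA : IsCoeff p A) {m n : ℤ}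
    (h : m ≠ 0 ∨ n ≠ 0) : Finite (zact p A ⟨m, n⟩).ker := by
  haveI := isElliptic_of_isCoeff hp8 hA
  have hN : m * m + n * n * p ≠ 0 := by
    have hp : (0 : ℤ) < p := by exact_mod_cast (Fact.out : p.Prime).pos
    rcases h with h | h
    · have := mul_self_pos.2 h; nlinarith [mul_self_nonneg n]
    · have := mul_pos (mul_self_pos.2 h) hp; nlinarith [mul_self_nonneg m]
  haveI : Finite (geomTorsion (curve p A) (m * m + n * n * p)) :=
    finite_torsionPoints_holds (curve p A) (AlgebraicClosure (ZMod p)) hN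
  exact Finite.of_injective (fun x : (zact p A ⟨m, n⟩).ker ↦
      (⟨x.1, ker_zact_le_geomTorsion hp8 hA m n x.2⟩ : geomTorsion (curve p A) (m * m + n * n * p)))
    fun a b hab ↦ Subtype.ext (by simpa using congrArg Subtype.val hab)

/-- **`#ker(m + nπ) ≥ p` for `gcd(m, n) = 1`, `p ∤ m`, `n ≠ 0`.** With `N = m² + n²p` (prime to
`p`, so `#E_A[N] = N²`), `z = m + nπ` maps `E_A[N]` into `E_A[N] ∩ ker(π - c)` for `c ≡ m/n`
(`z̄ z = N`), a set of `≤ N` points (`natCard_torsion_eigen_le`); hence `#ker z ≥ N²/N = N ≥ p`.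
[folklore] -/
theorem le_natCard_ker_zact_of_not_dvd (hp8 : p % 8 = 3) {A : ZMod p} (hA : IsCoeff p A)
    {m n : ℤ} (hcop : IsCoprime m n) (hpm : ¬ (p : ℤ) ∣ m) (hn : n ≠ 0) :
    p ≤ Nat.card (zact p A ⟨m, n⟩).ker := by
  haveI := isElliptic_of_isCoeff hp8 hA
  haveI : NeZero p := ⟨(Fact.out : p.Prime).ne_zero⟩
  set N : ℕ := m.natAbs ^ 2 + n.natAbs ^ 2 * p with hN
  have hNZ : (N : ℤ) = m * m + n * n * p := by
    rw [hN]; push_cast; rw [sq_abs, sq_abs]; ring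
  have hpN : p ≤ N := by
    have : 1 ≤ n.natAbs ^ 2 := Nat.one_le_pow _ _ (Int.natAbs_pos.2 hn)
    rw [hN]; nlinarith
  have hNpos : 0 < N := lt_of_lt_of_le (Fact.out : p.Prime).pos hpN
  have hpN' : ¬ p ∣ N := by
    intro h
    apply hpm
    have h1 : (p : ℤ) ∣ (N : ℤ) := Int.natCast_dvd_natCast.2 h
    rw [hNZ] at h1
    have h2 : (p : ℤ) ∣ m * m := (dvd_add_left (dvd_mul_left (p : ℤ) (n * n))).1 h1
    have hp : Prime (p : ℤ) := Nat.prime_iff_prime_int.mp Fact.out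
    rcases hp.dvd_or_dvd h2 with h | h <;> exact h
  -- `E[N]` has `N²` points
  have hcardE : Nat.card (geomTorsion (curve p A) N) = N ^ 2 :=
    natCard_geomTorsion_prime hp8 hA hpN'
  haveI : Finite (geomTorsion (curve p A) N) :=
    Nat.finite_of_card_ne_zero (by rw [hcardE]; positivity)
  set f := zact p A ⟨m, n⟩ with hf
  have hfT : ∀ T, f T = m • T + n • (frob p • T) := fun T ↦ rfl
  -- `ker f ≤ E[N]`
  have hkerle : f.ker ≤ geomTorsion (curve p A) N := by
    have := ker_zact_le_geomTorsion hp8 hA m n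
    rwa [← hNZ] at this
  -- Bezout: `a N + b n = 1`
  obtain ⟨a, b, hab⟩ : IsCoprime (N : ℤ) n := by
    rw [hNZ]
    have h1 : IsCoprime (m * m) n := hcop.mul_left hcop
    have e : m * m + n * n * (p : ℤ) = m * m + n * (n * p) := by ring
    rw [e]
    exact h1.add_mul_left_left (n * p)
  -- the image of `E[N]` under `f` lies in the eigenspace `π = c`, `c = b m`
  set c : ℤ := b * m with hc
  have himage : ∀ T : (curve p A).geomPoints, (N : ℤ) • T = 0 →
      (N : ℤ) • f T = 0 ∧ frob p • f T = c • f T := by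
    intro T hT
    have hNf : (N : ℤ) • f T = 0 := by rw [← map_zsmul, hT, map_zero]
    refine ⟨hNf, ?_⟩
    have hzz : m • f T - n • (frob p • f T) = 0 := by
      have e : m • f T - n • (frob p • f T) = (N : ℤ) • T := by
        rw [hfT, hNZ]
        simp only [smul_add, frob_smul_zsmul, frob_smul_frob_smul hp8 hA]
        generalize frob p • T = X
        module
      rw [e, hT]
    have h3 : (b * n) • (frob p • f T) = c • f T := by
      rw [hc, mul_smul, mul_smul, ← sub_eq_zero.1 hzz]
    have hNπ : (N : ℤ) • (frob p • f T) = 0 := by rw [← frob_smul_zsmul, hNf, smul_zero]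
    have h4 : (b * n) • (frob p • f T) = frob p • f T := by
      have e : b * n = 1 - a * N := by linarith
      rw [e, sub_smul, one_smul, mul_smul, hNπ, smul_zero, sub_zero]
    rw [← h4]
    exact h3
  -- restrict `f` to `E[N]`
  set TN := geomTorsion (curve p A) N with hTN
  set g : TN →+ (curve p A).geomPoints := f.comp TN.subtype with hg
  haveI := finite_torsion_eigen hp8 hA hNpos.ne' c
  have hrange : Nat.card g.range ≤ N := by
    refine le_trans (Nat.card_le_card_of_injective
      (fun y : g.range ↦ (⟨y.1, by
          obtain ⟨x, hx⟩ := y.2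
          rw [← hx]
          exact himage x ((Submodule.mem_torsionBy_iff _ _).1 x.2)⟩ :
        {T : (curve p A).geomPoints // (N : ℤ) • T = 0 ∧ frob p • T = c • T}))
      fun y₁ y₂ h ↦ ?_) (natCard_torsion_eigen_le hp8 hA hNpos c)
    simp only [Subtype.mk.injEq] at h
    exact Subtype.ext h
  have hker : Nat.card g.ker = Nat.card f.ker := by
    have e1 : g.ker = f.ker.addSubgroupOf TN := by
      rw [hg, ← AddMonoidHom.comap_ker]
      rfl
    rw [e1]
    exact Nat.card_congr (AddSubgroup.addSubgroupOfEquivOfLe hkerle).toEquiv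
  have hcardTN : Nat.card TN = Nat.card g.range * Nat.card g.ker := by
    rw [AddSubgroup.card_eq_card_quotient_mul_card_addSubgroup g.ker,
      Nat.card_congr (QuotientAddGroup.quotientKerEquivRange g).toEquiv]
  have key : N * N ≤ N * Nat.card f.ker := by
    calc N * N = Nat.card TN := by rw [hcardE, pow_two]
      _ = Nat.card g.range * Nat.card g.ker := hcardTN
      _ ≤ N * Nat.card f.ker := by rw [hker]; exact Nat.mul_le_mul_right _ hrange
  exact hpN.trans (Nat.le_of_mul_le_mul_left key hNpos)

/-- **`#ker(m + nπ) ≥ p` for `gcd(m, n) = 1`, `m, n ≠ 0`**: if `p ∣ m`, `m = pm'`, then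
`m + nπ = π (n - m'π)` has the same kernel as `n - m'π`, to which the previous case applies.
[folklore] -/
theorem le_natCard_ker_zact_of_isCoprime (hp8 : p % 8 = 3) {A : ZMod p} (hA : IsCoeff p A)
    {m n : ℤ} (hcop : IsCoprime m n) (hm : m ≠ 0) (hn : n ≠ 0) :
    p ≤ Nat.card (zact p A ⟨m, n⟩).ker := by
  by_cases hpm : (p : ℤ) ∣ m
  · obtain ⟨m', rfl⟩ := hpm
    have hm' : m' ≠ 0 := by rintro rfl; exact hm (mul_zero _)
    have hpn : ¬ (p : ℤ) ∣ n := fun h ↦ by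
      have hu := hcop.isUnit_of_dvd' (dvd_mul_right _ _) h
      rw [Int.isUnit_iff_natAbs_eq, Int.natAbs_natCast] at hu
      exact (Fact.out : p.Prime).one_lt.ne' hu
    have hker : (zact p A ⟨(p : ℤ) * m', n⟩).ker = (zact p A ⟨n, -m'⟩).ker := by
      ext T
      rw [AddMonoidHom.mem_ker, AddMonoidHom.mem_ker]
      show ((p : ℤ) * m') • T + n • (frob p • T) = 0 ↔ n • T + (-m') • (frob p • T) = 0
      have e : ((p : ℤ) * m') • T + n • (frob p • T) =
          frob p • (n • T + (-m') • (frob p • T)) := by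
        rw [smul_add, frob_smul_zsmul, frob_smul_zsmul, frob_smul_frob_smul hp8 hA]
        generalize frob p • T = X
        module
      rw [e, smul_eq_zero_iff_eq]
    rw [hker]
    exact le_natCard_ker_zact_of_not_dvd hp8 hA hcop.of_mul_left_right.symm.neg_right hpn
      (neg_ne_zero.2 hm')
  · exact le_natCard_ker_zact_of_not_dvd hp8 hA hcop hpm hn

/-- **`#ker(m + nπ) ≥ p` whenever `m ≠ 0` and `n ≠ 0`** (divide by `gcd(m, n)`: the kernel only
grows). [folklore] -/
theorem le_natCard_ker_zact (hp8 : p % 8 = 3) {A : ZMod p} (hA : IsCoeff p A)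
    {m n : ℤ} (hm : m ≠ 0) (hn : n ≠ 0) : p ≤ Nat.card (zact p A ⟨m, n⟩).ker := by
  haveI := finite_ker_zact hp8 hA (m := m) (n := n) (Or.inl hm)
  set d := Int.gcd m n with hd
  have hdpos : 0 < d := Int.gcd_pos_of_ne_zero_left n hm
  have hd0 : (d : ℤ) ≠ 0 := by exact_mod_cast hdpos.ne'
  obtain ⟨m₁, hm₁⟩ : (d : ℤ) ∣ m := Int.gcd_dvd_left ..
  obtain ⟨n₁, hn₁⟩ : (d : ℤ) ∣ n := Int.gcd_dvd_right ..
  have hcop : IsCoprime m₁ n₁ := by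
    rw [Int.isCoprime_iff_gcd_eq_one]
    have h1 := Int.gcd_div_gcd_div_gcd hdpos
    rw [← hd] at h1
    have e1 : m / d = m₁ := by rw [hm₁, Int.mul_ediv_cancel_left _ hd0]
    have e2 : n / d = n₁ := by rw [hn₁, Int.mul_ediv_cancel_left _ hd0]
    rwa [e1, e2] at h1
  have hm₁0 : m₁ ≠ 0 := by rintro rfl; exact hm (by rw [hm₁, mul_zero])
  have hn₁0 : n₁ ≠ 0 := by rintro rfl; exact hn (by rw [hn₁, mul_zero])
  have hle : (zact p A ⟨m₁, n₁⟩).ker ≤ (zact p A ⟨m, n⟩).ker := fun T hT ↦ by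
    rw [AddMonoidHom.mem_ker] at hT ⊢
    have e : zact p A ⟨m, n⟩ T = (d : ℤ) • zact p A ⟨m₁, n₁⟩ T := by
      rw [zact_apply, zact_apply, hm₁, hn₁]
      show ((d : ℤ) * m₁) • T + ((d : ℤ) * n₁) • (frob p • T) = (d : ℤ) • (m₁ • T + n₁ • (frob p • T))
      rw [smul_add, mul_smul, mul_smul]
    rw [e, hT, smul_zero]
  exact (le_natCard_ker_zact_of_isCoprime hp8 hA hcop hm₁0 hn₁0).trans
    (AddSubgroup.card_le_of_le hle)

/-- **A small kernel is the kernel of an integer or of an integer times `π`**: if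
`#ker(m + nπ) < p` then `m = 0` or `n = 0`. [folklore] -/
theorem eq_zero_or_eq_zero_of_natCard_ker_lt (hp8 : p % 8 = 3) {A : ZMod p} (hA : IsCoeff p A)
    {m n : ℤ} (hlt : Nat.card (zact p A ⟨m, n⟩).ker < p) : m = 0 ∨ n = 0 := by
  by_contra h
  rw [not_or] at h
  exact absurd (le_natCard_ker_zact hp8 hA h.1 h.2) (not_le.2 hlt)

/-! ### Labels of discriminant `-4p` -/

omit [Fact p.Prime] in
/-- Numerical data of a label `k = (a, b, c)` of discriminant `-4p` (`p ≥ 5`): `a > 0`, `b = 2b'`,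
`b'² + p = ac`, `|b| ≤ a`, and `a < p` (reduced: `|b| ≤ a ≤ c` gives `3a² ≤ 4p`).
[cite: Cox2013, §2.A, Thm. 2.8] -/
theorem label_data (hp5 : 5 ≤ p) {k : BinQF} (hk : IsLabel (-(p : ℤ)) k) :
    0 < k.a ∧ k.b = 2 * (k.b / 2) ∧ (k.b / 2) ^ 2 + p = k.a * k.c ∧ k.a < p ∧ |k.b| ≤ k.a := by
  obtain ⟨⟨hdisc, ha, -⟩, hred⟩ := hk
  have hb : Even k.b := even_b (-(p : ℤ)) hdisc
  set b' := k.b / 2 with hb'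
  have hb2 : k.b = 2 * b' := (Int.mul_ediv_cancel' (even_iff_two_dvd.mp hb)).symm
  rw [disc] at hdisc
  have hkey : b' ^ 2 + p = k.a * k.c := by
    rw [hb2] at hdisc
    linarith
  obtain ⟨hba, hac, -⟩ := hred
  refine ⟨ha, hb2, hkey, ?_, hba⟩
  by_contra hge
  rw [not_lt] at hge
  have hsq : k.b ^ 2 ≤ k.a ^ 2 := sq_le_sq' (abs_le.1 hba).1 (abs_le.1 hba).2
  have hbsq : k.b ^ 2 = 4 * b' ^ 2 := by rw [hb2]; ring
  have hac' : k.a * k.a ≤ k.a * k.c := mul_le_mul_of_nonneg_left hac ha.le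
  have h3 : 3 * k.a ^ 2 ≤ 4 * p := by nlinarith
  have h4 : (p : ℤ) ^ 2 ≤ k.a ^ 2 := by
    rw [sq, sq]
    exact mul_le_mul hge hge (by positivity) ha.le
  have hp5' : (5 : ℤ) ≤ p := by exact_mod_cast hp5
  nlinarith

/-- Transport of an isogeny `E_A → E_B` along `B = A`. [folklore] -/
theorem exists_endo_of_eq {A B : ZMod p} (h : B = A) (φ : (curve p A).Isogeny (curve p B))
    {K : AddSubgroup (curve p A).geomPoints} (hφ : φ.toAddMonoidHom.ker = K) :
    ∃ g : (curve p A).Isogeny (curve p A), g.toAddMonoidHom.ker = K := by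
  subst h
  exact ⟨φ, hφ⟩

/-! ### Point-wise freeness and freeness -/

/-- **Point-wise freeness** (CSIDH Thm. 7, "free"): for `p ≡ 3 (mod 8)`, `p ≥ 5`, a label `k` and
a valid `A`, if `act p k A = A` then `k` is the principal form `(1, 0, p)`. See the module
docstring for the proof. [cite: CastryckEtAl2018, §3 Thm. 7; Waterhouse1969, Thm. 4.5] -/
theorem eq_principalForm_of_act_eq (hp8 : p % 8 = 3) (hp5 : 5 ≤ p) {k : BinQF}
    (hk : IsLabel (-(p : ℤ)) k) {A : ZMod p} (hA : IsCoeff p A) (hfix : act p k A = A) :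
    k = principalForm (-(p : ℤ)) := by
  haveI := isElliptic_of_isCoeff hp8 hA
  haveI : NeZero p := ⟨(Fact.out : p.Prime).ne_zero⟩
  obtain ⟨ha, hb2, hkey, hap, hba⟩ := label_data hp5 hk
  -- an `𝔽_p`-endomorphism with kernel `E[𝔞_k]`, hence `m + nπ`
  obtain ⟨g, hgker⟩ : ∃ g : (curve p A).Isogeny (curve p A),
      g.toAddMonoidHom.ker = idealKernel p k A := by
    obtain ⟨φ, hφ⟩ := exists_isogeny_act' hp8 hk hA
    exact exists_endo_of_eq hfix φ hφ
  obtain ⟨m, n, hmn⟩ := exists_int_int_apply_eq hp8 hA g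
  have hgz : g.toAddMonoidHom = zact p A ⟨m, n⟩ :=
    AddMonoidHom.ext fun T ↦ by rw [zact_apply]; exact hmn T
  have hHz : (zact p A ⟨m, n⟩).ker = idealKernel p k A := by rw [← hgz, hgker]
  -- `#E[𝔞_k] ≤ a < p`
  have hcardH : Nat.card (idealKernel p k A) ≤ k.a.toNat := by
    have e : Nat.card (idealKernel p k A) = Nat.card {T : (curve p A).geomPoints //
        ((k.a.toNat : ℕ) : ℤ) • T = 0 ∧ frob p • T = (k.b / 2) • T} :=
      Nat.card_congr (Equiv.subtypeEquivRight fun T ↦ by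
        rw [mem_idealKernel_iff, Int.toNat_of_nonneg ha.le])
    rw [e]
    exact natCard_torsion_eigen_le hp8 hA (by omega) (k.b / 2)
  have hlt : Nat.card (zact p A ⟨m, n⟩).ker < p := by
    rw [hHz]
    exact hcardH.trans_lt (by omega)
  -- hence `m = 0` or `n = 0`, and `E[𝔞_k] = E[m₀]`
  have hne : m ≠ 0 ∨ n ≠ 0 := by
    by_contra h0
    rw [not_or, not_not, not_not] at h0
    obtain ⟨rfl, rfl⟩ := h0
    have hall : (g.toAddMonoidHom.ker : Set (curve p A).geomPoints) = Set.univ := by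
      ext T
      simp only [SetLike.mem_coe, AddMonoidHom.mem_ker, Isogeny.coe_toAddMonoidHom, Set.mem_univ,
        iff_true]
      rw [hmn T, zero_smul, zero_smul, add_zero]
    have hfin := g.finite_ker
    rw [hall] at hfin
    exact Set.infinite_univ (α := (curve p A).geomPoints) hfin
  obtain ⟨m₀, hm₀, hHm⟩ : ∃ m₀ : ℤ, m₀ ≠ 0 ∧ ∀ T, T ∈ idealKernel p k A ↔ m₀ • T = 0 := by
    rcases eq_zero_or_eq_zero_of_natCard_ker_lt hp8 hA hlt with rfl | rfl
    · refine ⟨n, hne.resolve_left (fun h ↦ h rfl), fun T ↦ ?_⟩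
      rw [← hHz, AddMonoidHom.mem_ker, zact_apply]
      show (0 : ℤ) • T + n • (frob p • T) = 0 ↔ n • T = 0
      rw [zero_smul, zero_add, ← frob_smul_zsmul, smul_eq_zero_iff_eq]
    · refine ⟨m, hne.resolve_right (fun h ↦ h rfl), fun T ↦ ?_⟩
      rw [← hHz, AddMonoidHom.mem_ker, zact_apply]
      show m • T + (0 : ℤ) • (frob p • T) = 0 ↔ m • T = 0
      rw [zero_smul, add_zero]
  -- `E[m₀] ⊆ ker(π - b')` forces `|m₀| = p^j`, so `E[𝔞_k] = O`
  have hH0 : ∀ T, T ∈ idealKernel p k A → T = 0 := by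
    have hprime : ∀ {ℓ : ℕ}, ℓ.Prime → ℓ ∣ m₀.natAbs → ℓ = p := by
      intro ℓ hℓ hℓm
      by_contra hℓp
      refine false_of_frob_eq_smul_on_torsion hp8 hA hℓ hℓp (k.b / 2) fun T hT ↦ ?_
      obtain ⟨q, hq⟩ := Int.natCast_dvd.2 hℓm
      have hm₀T : m₀ • T = 0 := by rw [hq, mul_comm, mul_smul, hT, smul_zero]
      exact ((mem_idealKernel_iff T).1 ((hHm T).2 hm₀T)).2
    obtain ⟨j, hj⟩ : ∃ j : ℕ, m₀.natAbs = p ^ j :=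
      ⟨_, Nat.eq_prime_pow_of_unique_prime_dvd (Int.natAbs_ne_zero.2 hm₀) hprime⟩
    intro T hT
    have h1 : m₀ • T = 0 := (hHm T).1 hT
    have h2 : (m₀.natAbs : ℤ) • T = 0 := by
      rcases Int.natAbs_eq m₀ with h | h
      · rwa [← h]
      · rw [h, neg_smul, neg_eq_zero] at h1
        exact h1
    rw [hj, Nat.cast_pow] at h2
    exact eq_zero_of_p_pow_zsmul hp8 hA j h2
  -- `a = 1`: otherwise a prime `ℓ ∣ a` yields a non-zero point of `E[ℓ] ∩ ker(π - b') ⊆ E[𝔞_k]`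
  have ha1 : k.a = 1 := by
    by_contra ha1
    set ℓ := k.a.toNat.minFac with hℓdef
    have hℓ : ℓ.Prime := Nat.minFac_prime (by omega)
    have hℓa : (ℓ : ℤ) ∣ k.a := by
      have h := Int.natCast_dvd_natCast.2 (Nat.minFac_dvd k.a.toNat)
      rwa [Int.toNat_of_nonneg ha.le] at h
    have hℓp : ℓ ≠ p := by
      intro h
      have : (ℓ : ℤ) ≤ k.a := Int.le_of_dvd ha hℓa
      rw [h] at this
      omega
    haveI : Finite (geomTorsion (curve p A) ℓ) :=
      finite_torsionPoints_holds (curve p A) (AlgebraicClosure (ZMod p))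
        (by exact_mod_cast hℓ.ne_zero)
    -- `(π + b')(π - b') = 0` on `E[ℓ]`
    have hann : ∀ T : (curve p A).geomPoints, (ℓ : ℤ) • T = 0 →
        frob p • (frob p • T - (k.b / 2) • T) + (k.b / 2) • (frob p • T - (k.b / 2) • T) = 0 := by
      intro T hT
      obtain ⟨q, hq⟩ := hℓa
      have haT : k.a • T = 0 := by rw [hq, mul_comm, mul_smul, hT, smul_zero]
      have hacT : ((k.b / 2) ^ 2 + p) • T = 0 := by
        rw [hkey, mul_comm, mul_smul, haT, smul_zero]
      rw [smul_sub, frob_smul_frob_smul hp8 hA, frob_smul_zsmul, smul_sub]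
      generalize frob p • T = X
      linear_combination (norm := module) (-1 : ℤ) • hacT
    -- the map `π - b'` on `E[ℓ]` is not injective
    let D : geomTorsion (curve p A) ℓ → geomTorsion (curve p A) ℓ := fun T ↦
      ⟨frob p • (T : (curve p A).geomPoints) - (k.b / 2) • (T : (curve p A).geomPoints),
        (Submodule.mem_torsionBy_iff _ _).2 (by
          have hT := (Submodule.mem_torsionBy_iff _ _).1 T.2
          show (ℓ : ℤ) • (frob p • (T : (curve p A).geomPoints) -
            (k.b / 2) • (T : (curve p A).geomPoints)) = 0
          rw [smul_sub, ← frob_smul_zsmul, smul_comm (ℓ : ℤ) (k.b / 2), hT, smul_zero, smul_zero,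
            sub_zero])⟩
    have hDinj : ¬ Function.Injective D := by
      intro hinj
      have hsurj := Finite.surjective_of_injective hinj
      refine false_of_frob_eq_smul_on_torsion hp8 hA hℓ hℓp (-(k.b / 2)) fun T hT ↦ ?_
      obtain ⟨S, hS⟩ := hsurj ⟨T, (Submodule.mem_torsionBy_iff _ _).2 hT⟩
      have hS' : frob p • (S : (curve p A).geomPoints) -
          (k.b / 2) • (S : (curve p A).geomPoints) = T := congrArg Subtype.val hS
      have h1 := hann S ((Submodule.mem_torsionBy_iff _ _).1 S.2)
      rw [hS'] at h1
      rw [neg_smul]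
      exact eq_neg_of_add_eq_zero_left h1
    have hD2 : ∃ T₁ T₂, D T₁ = D T₂ ∧ T₁ ≠ T₂ := by
      simp only [Function.Injective, not_forall] at hDinj
      obtain ⟨T₁, T₂, hD, hne⟩ := hDinj
      exact ⟨T₁, T₂, hD, hne⟩
    obtain ⟨T₁, T₂, hD, hne12⟩ := hD2
    apply hne12
    have hℓ12 : (ℓ : ℤ) • ((T₁ : (curve p A).geomPoints) - T₂) = 0 := by
      rw [smul_sub, (Submodule.mem_torsionBy_iff _ _).1 T₁.2, (Submodule.mem_torsionBy_iff _ _).1 T₂.2,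
        sub_zero]
    have hdiff : (T₁ : (curve p A).geomPoints) - T₂ ∈ idealKernel p k A := by
      rw [mem_idealKernel_iff]
      constructor
      · obtain ⟨q, hq⟩ := hℓa
        rw [hq, mul_comm, mul_smul, hℓ12, smul_zero]
      · have h1 : frob p • (T₁ : (curve p A).geomPoints) - (k.b / 2) • (T₁ : (curve p A).geomPoints) =
            frob p • (T₂ : (curve p A).geomPoints) - (k.b / 2) • (T₂ : (curve p A).geomPoints) :=
          congrArg Subtype.val hD
        rw [smul_sub, smul_sub]
        generalize frob p • (T₁ : (curve p A).geomPoints) = X₁ at h1 ⊢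
        generalize frob p • (T₂ : (curve p A).geomPoints) = X₂ at h1 ⊢
        linear_combination (norm := module) h1
    exact Subtype.ext (sub_eq_zero.1 (hH0 _ hdiff))
  -- `a = 1` ⇒ `k = (1, 0, p)`
  have hb0 : k.b = 0 := by
    rw [ha1] at hba
    obtain ⟨h1, h2⟩ := abs_le.1 hba
    omega
  have hc : k.c = p := by
    have hb' : k.b / 2 = 0 := by omega
    rw [hb', ha1] at hkey
    linarith
  exact BinQF.ext ha1 hb0 (by rw [hc]; simp [principalForm])

/-- **Freeness of the CSIDH action** (clause (3), uniqueness half): labels acting identically on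
a valid `A` are equal. Castryck–Lange–Martindale–Panny–Renes, CSIDH Thm. 7 ("`cl(𝒪)` acts
freely"). [cite: CastryckEtAl2018, §3 Thm. 7; Waterhouse1969, Thm. 4.5] -/
theorem eq_of_act_eq_act (hp8 : p % 8 = 3) (hp5 : 5 ≤ p) {f g : BinQF}
    (hf : IsLabel (-(p : ℤ)) f) (hg : IsLabel (-(p : ℤ)) g) {A : ZMod p} (hA : IsCoeff p A)
    (h : act p f A = act p g A) : f = g :=
  eq_of_act_eq_act_of_free hp8 hp5
    (fun _ _ hk hA' h' ↦ eq_principalForm_of_act_eq hp8 hp5 hk hA' h') hf hg hA h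

/-- **Clause (3) of `csidh_classGroupAction` from transitivity alone**: given a label joining any
two valid coefficients, the label is unique (`eq_of_act_eq_act`). [cite: CastryckEtAl2018, §3 Thm. 7] -/
theorem existsUnique_label_of_exists (hp8 : p % 8 = 3) (hp5 : 5 ≤ p) {A₀ A₁ : ZMod p}
    (hA₀ : IsCoeff p A₀)
    (hex : ∃ f : BinQF, IsLabel (-(p : ℤ)) f ∧ act p f A₀ = A₁) :
    ∃! f : BinQF, IsLabel (-(p : ℤ)) f ∧ act p f A₀ = A₁ := by
  obtain ⟨f, hf, hfA⟩ := hex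
  exact ⟨f, ⟨hf, hfA⟩, fun g ⟨hg, hgA⟩ ↦ eq_of_act_eq_act hp8 hp5 hg hf hA₀ (hgA.trans hfA.symm)⟩

/-- **`csidh_classGroupAction` modulo transitivity**: clauses (1), (2) and the uniqueness half of
(3) are theorems of the tree; the remaining input is the existence of a label joining two valid
coefficients (CSIDH Thm. 7 "transitively", which rests on Tate's isogeny theorem, the tree's
unproved `Literature.AlgebraicGeometry.Motives.isIsogenous_iff_card_point_eq`).
[cite: CastryckEtAl2018, §3 Thm. 7] -/
theorem csidh_classGroupAction_of_transitive
    (htrans : ∀ (p : ℕ) [Fact p.Prime], p % 8 = 3 → 5 ≤ p → ∀ A₀ A₁ : ZMod p,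
      IsCoeff p A₀ → IsCoeff p A₁ → ∃ f : BinQF, IsLabel (-(p : ℤ)) f ∧ act p f A₀ = A₁) :
    csidh_classGroupAction := fun p _ hp8 hp5 ↦
  ⟨fun _ hf _ hA ↦ existsUnique_isActResult' hp8 hf hA,
    fun _ _ hf hg _ hA ↦ act_comp' hp8 hp5 hf hg hA,
    fun A₀ A₁ h₀ h₁ ↦ existsUnique_label_of_exists hp8 hp5 h₀ (htrans p hp8 hp5 A₀ A₁ h₀ h₁)⟩

end Literature.Computability.Cryptography.Csidh
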